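import Literature.MathematicalPhysics.QuantumFieldTheory.Balaban1983to89.T4LiveClassFibration
import Literature.MathematicalPhysics.QuantumFieldTheory.Balaban1983to89.T4LiveStructureGas

/-!
# `Balaban1983to89.T4LiveGasToTerms` — COMPOSITION WITNESS: the sibling's live-structure gas ((G4) over LIVE CLASSES,
`T4LiveStructureGas`, COUNT member t4-ne7b-p1 gen 7, p188497) ∘ this lineage's class fibration
(`T4LiveClassFibration`, RENEWAL member t4-ne7b-p2 gen 7, p188543) ⇒ the kernel's TERM-level weight slot
(cell `pub-balaban`, T4-DAG §5 self-row T4-U5c.E-NE7b-PROVE-P2g* (§8 Q24(a)), node U5c / U5.E, spine estimate NE7b;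
kernel bookkeeping; imports the two named tree leaves BY NAME and modifies nothing; census item v21 of
`t4/T4-EST-NE7b-P2.md`)

HONEST FRAMING (T4-DAG PAGE 1).  The cell's T4 target is the existence and uniqueness of the `ε → 0` limit of
unit-scale block-averaged expectations on a FIXED finite torus, at rung (B)+1, CONDITIONAL on Bałaban's ultraviolet
stability (B) and on BetaPertH; it is NOT infinite volume, NOT the mass gap, NOT the Clay problem.  This module is
[folklore] composition of two landed [folklore] modules; NOTHING of Bałaban's is asserted, no printed sentence is
quoted; every analytic input ((G2), (R3′), (RS), (G5) of `T4LiveClassFibration.Regeneration` / `GlobalDom`, the slot-price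
majorants `hold` / `hlive`, the domination of the RESUMMED live price by a live-family weight) is a displayed binder.
Value = the kernel certificate that the two gen-7 leaves of node U5c's (GD) docket COMPOSE BY NAME, binder for binder
(journal 2026-08-19: «the two leaves compose by name, neither imports the other's unlanded text»); NOT summit progress,
NOT a proof of NE7b; walls G-ne7bp1-1 / G-ne7bp2-1 neither narrowed nor widened.

CONTENTS.  §1 `exists_relWeightBound_of_liveGas_classes`: the sibling's `exists_relWeightBound_of_liveGas` instantiated
AT THE CLASS LEVEL (indices := live classes `γ`, weights := class weights, bad := a class-level bad set, the live-family
labelling `str K : γ → Finset σ` injective on the bad classes — true by construction there) and pushed forward to TERMS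
by `T4LiveClassFibration.relWeightBound_of_classes`: ∃ K₁ ≥ K₀, `RelWeightBound l₀ T A B (𝟙_{K ≥ K₁}·badOfClass π T Bad′)
(𝟙_{K ≥ K₁}·C·mold·exp mlive)`.  §2 `exists_relWeightBound_of_regeneration_liveGas`: the same from TERM-level data in
the regeneration reading (`Regeneration` ×2) when the RESUMMED live price `F K c · R K c` is dominated by the live-family
weight `famWeight (q K) (str K c)` of INFLATED slot prices (the resummation factor riding on the price).  §3 a decided
toy: `T4LiveClassFibration`'s two-element-fibre toy run fed through the sibling's gas with one slot (`σ = Unit`,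
price `2^{−K}`), all binders discharged at once, threshold `K₁ ≥ 1` produced.  §4 (v1.1) `exists_relWeightBound_of_regeneration_recordsGas`:
the RECORDS-CURRENCY corollary (the sibling's `exists_relWeightBound_of_recordsGas` in place of the abstract majorants;
`W = 𝟙_{K ≥ K₁}·C·recordsBudget`), statement and proof contributed by t4-ne7b-p1-g7 and folded verbatim.

VERSION.  v1 = p188628 (2026-08-19, §1–§3).  v1.1 = this file: §4 appended; §1–§3 byte-identical.
-/

open Finset

namespace Literature.MathematicalPhysics.QuantumFieldTheory.Balaban1983to89.T4LiveGasToTerms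

open T4WeightBudget T4GlobalDenominator T4LiveClassFibration T4LiveStructureGas

/-! ## §1 Class-level live gas ⇒ term-level slot -/

section Classes

variable {ι γ σ : Type*} [DecidableEq γ] [DecidableEq σ] {l₀ : ℝ} {K₀ : ℕ} {π : ℕ → ι → γ} {T : ℕ → Finset ι}
  {A B : ℕ → ℝ → ι → ℝ} {Bad' : ℕ → ℝ → Finset γ} {F G : ℕ → γ → ℝ} {nlow nup mlow mup : ℕ → ℝ → ℝ} {C : ℝ}

/-- **CLASS-LEVEL LIVE GAS ⇒ TERM-LEVEL SLOT.**  The sibling's `T4LiveStructureGas.exists_relWeightBound_of_liveGas`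
with indices := live classes (`classIndex π T`, `classWeight π T A`, `classWeight π T B`, class-level bad set `Bad'`,
live families `str K c` injective on `Bad' K t`), followed by the pushforward `relWeightBound_of_classes`: the kernel's
`RelWeightBound` for the TERM families with the saturated bad set `badOfClass π T Bad'` emptied below a threshold
`K₁ ≥ K₀` and `W = 𝟙_{K ≥ K₁} · C · (mold · exp mlive)`. [folklore] -/
theorem exists_relWeightBound_of_liveGas_classes (U O : ℕ → Finset σ) (hO : ∀ K, O K ⊆ U K)
    (q : ℕ → σ → ℝ) (hq : ∀ K, ∀ s ∈ U K, 0 ≤ q K s) (str : ℕ → γ → Finset σ)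
    (hinj : ∀ K t, |t| ≤ l₀ → K₀ ≤ K → Set.InjOn (str K) (Bad' K t))
    (hstr : ∀ K t, |t| ≤ l₀ → K₀ ≤ K → ∀ c ∈ Bad' K t, str K c ⊆ U K ∧ ∃ o ∈ O K, o ∈ str K c)
    {mold mlive : ℕ → ℝ} (hmold0 : ∀ K, 0 ≤ mold K) (hold : ∀ K, K₀ ≤ K → ∑ o ∈ O K, q K o ≤ mold K)
    (hlive : ∀ K, K₀ ≤ K → ∑ s ∈ U K, q K s ≤ mlive K)
    (hMs : Summable fun K => mold K * Real.exp (mlive K))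
    (hA : GlobalDom l₀ (classIndex π T) (classWeight π T A) Bad' F nlow nup C K₀)
    (hB : GlobalDom l₀ (classIndex π T) (classWeight π T B) Bad' G mlow mup C K₀)
    (hF : ∀ K t, |t| ≤ l₀ → K₀ ≤ K → ∀ c ∈ Bad' K t, F K c ≤ famWeight (q K) (str K c))
    (hG : ∀ K t, |t| ≤ l₀ → K₀ ≤ K → ∀ c ∈ Bad' K t, G K c ≤ famWeight (q K) (str K c)) (hC : 0 ≤ C) :
    ∃ K₁, K₀ ≤ K₁ ∧ RelWeightBound l₀ T A B (fun K t => if K₁ ≤ K then badOfClass π T Bad' K t else ∅)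
      (Set.indicator {K | K₁ ≤ K} (fun K => C * (mold K * Real.exp (mlive K)))) := by
  obtain ⟨K₁, h01, h⟩ :=
    exists_relWeightBound_of_liveGas U O hO q hq str hinj hstr hmold0 hold hlive hMs hA hB hF hG hC
  refine ⟨K₁, h01, ?_⟩
  rw [← badOfClass_ite_fun K₁]
  exact relWeightBound_of_classes h

/-! ## §2 Term-level regeneration data + inflated-price live gas ⇒ term-level slot -/

/-- **REGENERATION READING + LIVE GAS WITH INFLATED PRICES ⇒ TERM-LEVEL SLOT.**  Two runs given by TERM-level data
in the regeneration reading (`T4LiveClassFibration.Regeneration`: (G2), (R3′) dead-past factor × live price × envelope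
on the bad fibres, (RS) fibre resummation `≤ R`, (G5)), whose RESUMMED live prices `F K c · R K c` (resp.
`G K c · R' K c`) are dominated on the bad classes by the live-family weights `famWeight (q K) (str K c)` of the
sibling's gas (slot prices INFLATED by the per-structure resummation factors), plus the gas majorants `hold` / `hlive`
and the summable budget `mold · exp mlive` ⇒ the kernel's term-level `RelWeightBound` from some `K₁ ≥ K₀`.
By `Regeneration.globalDom` and §1. [folklore] -/
theorem exists_relWeightBound_of_regeneration_liveGas {dead deadB : ℕ → ℝ → ι → ℝ} {R R' : ℕ → γ → ℝ}
    (U O : ℕ → Finset σ) (hO : ∀ K, O K ⊆ U K)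
    (q : ℕ → σ → ℝ) (hq : ∀ K, ∀ s ∈ U K, 0 ≤ q K s) (str : ℕ → γ → Finset σ)
    (hinj : ∀ K t, |t| ≤ l₀ → K₀ ≤ K → Set.InjOn (str K) (Bad' K t))
    (hstr : ∀ K t, |t| ≤ l₀ → K₀ ≤ K → ∀ c ∈ Bad' K t, str K c ⊆ U K ∧ ∃ o ∈ O K, o ∈ str K c)
    {mold mlive : ℕ → ℝ} (hmold0 : ∀ K, 0 ≤ mold K) (hold : ∀ K, K₀ ≤ K → ∑ o ∈ O K, q K o ≤ mold K)
    (hlive : ∀ K, K₀ ≤ K → ∑ s ∈ U K, q K s ≤ mlive K)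
    (hMs : Summable fun K => mold K * Real.exp (mlive K))
    (hA : Regeneration l₀ π T A Bad' dead F R nlow nup C K₀)
    (hB : Regeneration l₀ π T B Bad' deadB G R' mlow mup C K₀)
    (hF : ∀ K t, |t| ≤ l₀ → K₀ ≤ K → ∀ c ∈ Bad' K t, F K c * R K c ≤ famWeight (q K) (str K c))
    (hG : ∀ K t, |t| ≤ l₀ → K₀ ≤ K → ∀ c ∈ Bad' K t, G K c * R' K c ≤ famWeight (q K) (str K c))
    (hC : 0 ≤ C) :
    ∃ K₁, K₀ ≤ K₁ ∧ RelWeightBound l₀ T A B (fun K t => if K₁ ≤ K then badOfClass π T Bad' K t else ∅)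
      (Set.indicator {K | K₁ ≤ K} (fun K => C * (mold K * Real.exp (mlive K)))) :=
  exists_relWeightBound_of_liveGas_classes U O hO q hq str hinj hstr hmold0 hold hlive hMs hA.globalDom hB.globalDom
    hF hG hC

end Classes

/-! ## §3 A decided toy: the two-element-fibre regeneration toy through a one-slot live gas -/

section Toy

/-- the toy's single live slot carries the price `2^{−K}` [folklore] -/
noncomputable def ctoyq (K : ℕ) (_u : Unit) : ℝ := (1 / 2 : ℝ) ^ K

/-- the toy's live families: the live class `true` consists of the one slot, `false` of none [folklore] -/
def ctoyStr (_K : ℕ) (b : Bool) : Finset Unit := if b then {()} else ∅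

/-- **EVERY BINDER AT ONCE.**  `T4LiveClassFibration`'s toy run (`rtoyT`, `rtoyA`: terms `Bool × Bool`, live bit ×
dead bit; `regeneration_rtoy`: `R ≡ 1`, `nlow = nup = e^t`, `C = 1`, `K₀ = 1`) through the sibling's gas with one
slot of price `2^{−K}` (`U = O = {()}`, `mold = mlive = 2^{−K}`, budget `2^{−K} · exp 2^{−K} ≤ e · 2^{−K}` summable):
the term-level `RelWeightBound` from some `K₁ ≥ 1`, with the saturated two-term bad set. [folklore] -/
theorem exists_relWeightBound_ctoy (l₀ : ℝ) :
    ∃ K₁, 1 ≤ K₁ ∧ RelWeightBound l₀ rtoyT rtoyA rtoyA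
      (fun K t => if K₁ ≤ K then badOfClass rtoyπ rtoyT (fun _ _ => ({true} : Finset Bool)) K t else ∅)
      (Set.indicator {K | K₁ ≤ K} (fun K => 1 * ((1 / 2 : ℝ) ^ K * Real.exp ((1 / 2 : ℝ) ^ K)))) := by
  have hdom : ∀ (K : ℕ) (t : ℝ), |t| ≤ l₀ → 1 ≤ K → ∀ c ∈ ({true} : Finset Bool),
      rtoyF K c * (fun (_ : ℕ) (_ : Bool) => (1 : ℝ)) K c ≤ famWeight (ctoyq K) (ctoyStr K c) := by
    intro K t _ _ c hc
    rw [Finset.mem_singleton] at hc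
    subst hc
    simp only [rtoyF, ctoyStr, if_true, famWeight, Finset.prod_singleton, ctoyq, mul_one]
    exact le_rfl
  refine exists_relWeightBound_of_regeneration_liveGas (fun _ => {()}) (fun _ => {()}) (fun _ => subset_rfl)
    ctoyq (fun K _ _ => by unfold ctoyq; positivity) ctoyStr (fun K t _ _ => Set.subsingleton_of_subset_singleton
      (fun c hc => by simpa using hc) |>.injOn _) (fun K t _ _ c hc => ?_) (mold := fun K => (1 / 2 : ℝ) ^ K)
    (mlive := fun K => (1 / 2 : ℝ) ^ K) (fun K => by positivity) (fun K _ => by simp [ctoyq])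
    (fun K _ => by simp [ctoyq]) ?_ (regeneration_rtoy l₀) (regeneration_rtoy l₀) hdom hdom zero_le_one
  · rw [Finset.mem_singleton] at hc
    subst hc
    exact ⟨by simp [ctoyStr], (), Finset.mem_singleton_self _, by simp [ctoyStr]⟩
  · -- `2^{−K} · exp 2^{−K} ≤ e · 2^{−K}`, summable
    refine Summable.of_nonneg_of_le (fun K => by positivity) (fun K => ?_)
      ((summable_geometric_of_lt_one (by norm_num : (0 : ℝ) ≤ 1 / 2) (by norm_num)).mul_left (Real.exp 1))
    have h1 : (1 / 2 : ℝ) ^ K ≤ 1 := pow_le_one₀ (by norm_num) (by norm_num)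
    have h2 : Real.exp ((1 / 2 : ℝ) ^ K) ≤ Real.exp 1 := Real.exp_le_exp.2 h1
    have h3 : 0 ≤ (1 / 2 : ℝ) ^ K := by positivity
    calc (1 / 2 : ℝ) ^ K * Real.exp ((1 / 2 : ℝ) ^ K) ≤ (1 / 2 : ℝ) ^ K * Real.exp 1 :=
          mul_le_mul_of_nonneg_left h2 h3
      _ = Real.exp 1 * (1 / 2 : ℝ) ^ K := mul_comm _ _

end Toy

/-! ## §4 (v1.1) The records-currency corollary — statement and proof contributed by the sibling seat t4-ne7b-p1-g7
(scratch certificate `HOME/t4/b2b-balaban-t4-ne7b-p1/g7/ComposeCheckRecords.lean`, sha256[:16] 22760717869cdfc8, journal NOTE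
2026-08-19T13:49:13Z), folded here verbatim (one-writer file of the renewal member) -/

section Records

open T4PersistentHistoryCount

/-- **REGENERATION READING + THE RECORDS GAS ⇒ TERM-LEVEL SLOT (records currency).**  Two TERM-level runs in the
regeneration reading (`Regeneration`, renewal member) + the count member's records gas over the typed live slots
(`T4LiveStructureGas.exists_relWeightBound_of_recordsGas`: cells `≤ V·Λ^a`, event universes on `(j, K]`, kinds with
`Σρ ≤ ρ̄`, residual entropy `≤ η̄` per step, `0 ≤ κ₁`, `Λ·e^{η̄−κ₁} < 1`, `j⋆ ≤ K` with `c·K ≤ K − j⋆K`, prices `y ≥ 0` under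
the ABSOLUTE per-record majorant `hy` for EVERY live slot — the located-unprinted input G-ne7bp1-1 / (G3), a binder —
live families `str K c ⊆ liveSlots K` injective on `Bad' K t` and containing an old slot) + domination of the RESUMMED
class prices `F K c · R K c`, `F' K c · R' K c` by `famWeight (slotPrice (y K)) (str K c)` + `0 ≤ C` ⇒ ∃ K₁ ≥ K₀, the
kernel's term-level `RelWeightBound` with the saturated bad set and `W = 𝟙_{K ≥ K₁} · C · recordsBudget ρ̄ κ₁ V Λ η̄ j⋆`.
Proof: `exists_relWeightBound_of_recordsGas` on `Regeneration.globalDom` ×2, then `relWeightBound_of_classes`.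
(contributed by t4-ne7b-p1-g7) [folklore] -/
theorem exists_relWeightBound_of_regeneration_recordsGas {γ ε κ ι : Type*} [DecidableEq γ] [DecidableEq ε]
    [DecidableEq κ] {l₀ : ℝ} {K₀ : ℕ} {π : ℕ → ι → κ} {T : ℕ → Finset ι}
    {A A' : ℕ → ℝ → ι → ℝ} {Bad' : ℕ → ℝ → Finset κ} {dead dead' : ℕ → ℝ → ι → ℝ} {F R F' R' : ℕ → κ → ℝ}
    {nlow nup mlow mup : ℕ → ℝ → ℝ} {C : ℝ}
    (Cell : ℕ → ℕ → Finset γ) {V Λ : ℝ} (hV : 0 ≤ V) (hΛ : 0 < Λ)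
    (hcell : ∀ K a, ((Cell K a).card : ℝ) ≤ V * Λ ^ a) (W : ε → ℕ) (step : ε → ℕ) (E B : ℕ → ℕ → Finset ε)
    (hE : ∀ K j, ∀ e ∈ E K j, step e ∈ Ioc j K) {κ₁ ρbar ηbar : ℝ} (hκ : 0 ≤ κ₁) (ρ : ε → ℝ)
    (hρ : ∀ K j, ∀ b ∈ B K j, 0 ≤ ρ b) (hρbar : ∀ K j, ∑ b ∈ B K j, ρ b ≤ ρbar) (η : ε → ℝ)
    (hη : ∀ K j, ∀ e ∈ E K j, 0 ≤ η e)
    (hηbar : ∀ K j, ∀ t ∈ Ioc j K, ∑ e ∈ E K j with step e = t, η e ≤ ηbar)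
    (hr : Λ * Real.exp (ηbar - κ₁) < 1) (jstar : ℕ → ℕ) (hj : ∀ K, jstar K ≤ K) {c : ℝ} (hc : 0 < c)
    (hfrac : ∀ K : ℕ, c * K ≤ ((K - jstar K : ℕ) : ℝ)) (y : ℕ → ℕ → γ → ε → Finset ε → ℝ)
    (hy0 : ∀ K, ∀ j ≤ K, ∀ z ∈ Cell K (K - j), ∀ b ∈ B K j, ∀ Q ∈ records W j K (E K j) b, 0 ≤ y K j z b Q)
    (hy : ∀ K, ∀ j ≤ K, ∀ z ∈ Cell K (K - j), ∀ b ∈ B K j, ∀ Q ∈ records W j K (E K j) b,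
      y K j z b Q ≤ ρ b * Real.exp (-(κ₁ * W b)) * ∏ e ∈ Q, (Real.exp (-(κ₁ * W e)) * η e))
    (str : ℕ → κ → Finset (Slot γ ε))
    (hinj : ∀ K t, |t| ≤ l₀ → K₀ ≤ K → Set.InjOn (str K) (Bad' K t))
    (hstr : ∀ K t, |t| ≤ l₀ → K₀ ≤ K → ∀ c ∈ Bad' K t,
      str K c ⊆ liveSlots Cell W E B K ∧ ∃ o ∈ oldSlots Cell W E B jstar K, o ∈ str K c)
    (hA : Regeneration l₀ π T A Bad' dead F R nlow nup C K₀)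
    (hA' : Regeneration l₀ π T A' Bad' dead' F' R' mlow mup C K₀)
    (hF : ∀ K t, |t| ≤ l₀ → K₀ ≤ K → ∀ c ∈ Bad' K t, F K c * R K c ≤ famWeight (slotPrice (y K)) (str K c))
    (hF' : ∀ K t, |t| ≤ l₀ → K₀ ≤ K → ∀ c ∈ Bad' K t, F' K c * R' K c ≤ famWeight (slotPrice (y K)) (str K c))
    (hC : 0 ≤ C) :
    ∃ K₁, K₀ ≤ K₁ ∧ RelWeightBound l₀ T A A' (fun K t => if K₁ ≤ K then badOfClass π T Bad' K t else ∅)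
      (Set.indicator {K | K₁ ≤ K} (fun K => C * recordsBudget ρbar κ₁ V Λ ηbar jstar K)) := by
  obtain ⟨K₁, h01, h⟩ := exists_relWeightBound_of_recordsGas Cell hV hΛ hcell W step E B hE hκ ρ hρ hρbar η hη
    hηbar hr jstar hj hc hfrac y hy0 hy str hinj hstr hA.globalDom hA'.globalDom hF hF' hC
  refine ⟨K₁, h01, ?_⟩
  rw [← badOfClass_ite_fun K₁]
  exact relWeightBound_of_classes h

end Records

end Literature.MathematicalPhysics.QuantumFieldTheory.Balaban1983to89.T4LiveGasToTerms
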